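import Literature.AlgebraicGeometry.Resolution.EffectiveResolutionSpread
import Mathlib.RingTheory.MvPolynomial.Homogeneous
import HarnessLib

/-!
# EL♮(3) / EL♮(n), RUNG LC «large characteristic» — brick (B1): THE UNIVERSAL DEGREE-`d` FORM IN `n + 1` VARIABLES

Sub-problem `ResolutionOfSingularities`, crux `EquisingularLiftNatThree` (`stmt-ResolutionOfSingularities-20148`; the rung is uniform in `n`, so
also `stmt-…-20038`), line W4.5(b) (L1 RESCUE), idea-2 g32's `LARGE-CHAR-RUNG-idea2.md` v1.1 §2 (B1) «UNIVERSAL HYPERSURFACE» (desk R93: RUNG LC =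
the chain's one ATTACKABLE leaf).  PROJECTIVE twin of the tree's affine universal family ✓ `CoeffRing` / `univPoly` / `coeffHom` /
`span_univFamily_coeffHom` (`Literature/AlgebraicGeometry/Resolution/EffectiveResolutionSpread`, exponents `≤ d`): here the coefficients are
indexed by the monomials of TOTAL DEGREE EXACTLY `d`, so the universal form is HOMOGENEOUS of degree `d` over EVERY base — which is what a family of
projective hypersurfaces `V₊(F) ⊂ ℙⁿ` needs — and every degree-`d` form over any ring is its specialisation along a unique ring map.

* `LargeChar.HomIdx n d` — exponent vectors `e : Fin (n+1) → Fin (d+1)` with `∑ eᵢ = d` (a `Fintype`);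
* `LargeChar.CoeffRingP n d := ℤ[c_e : e ∈ HomIdx n d]` (Noetherian);
* `LargeChar.univHyp n d φ := ∑_e φ(c_e) · x^e` — the universal form specialised along `φ : CoeffRingP n d →+* A`;
* `LargeChar.coeffHomP F : CoeffRingP n d →+* A`, `c_e ↦ coeff_{x^e} F`;
* `isHomogeneous_univHyp` (degree `d`, every `φ`), `map_univHyp` (base change), `univHyp_coeffHomP` (every degree-`d` form is a specialisation),
  `eq_coeffHomP_of_univHyp_eq` (uniqueness), `lt_of_prime_mem_ker_coeffHomP` (the residue-characteristic clause of
  ✓ `exists_bound_forall_prime_of_generic` at a `k`-point, `k` of characteristic `p > M`).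

NEAREST TREE DECL (searched; not reused, on purpose): `Literature.AlgebraicGeometry.Motives.UniversalHypersurface.{DegIndex, CoeffRing k n d,
universalForm, coeffHom, map_coeffHom_universalForm}` (Motives/UniversalHypersurfaceFamily :110–:134, :394–:399; the Hodge route's universal
SMOOTH hypersurface of `ℙⁿ⁺¹` over a base ring `k`, `Finsupp` exponents, `coeffHom` a `k`-ALGEBRA map for forms over the same `k`).  The rung needs
(i) the variables `Fin (n + 1)` of ELNat's `projectiveSpace n k` (not `Fin (n + 2)`), (ii) base `ℤ` with specialisation along an ARBITRARY ring
map `ℤ[c] → A` and the RING map `coeffHomP F : ℤ[c] → k` of a form over a field of characteristic `p` (there is no `ℤ`-algebra point in the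
Motives API), (iii) the `expVec`/`Fin (d+1)`-function indexing of the Resolution-side twin ✓ `EffectiveResolutionSpread` it is glued to in (B6),
and (iv) a light import cone (no Hodge-theory modules under `Theorems/EquisingularLift*`).  A one-lemma bridge to the Motives family can be
added if a consumer ever wants both (idea-2 g32 l.39488/l.39511: «fallback = reindexing lemma, not a rewrite»).

[OURS · res-L1-w45b-stub-2 g21 · standard axioms · `--supports stmt-ResolutionOfSingularities-20148 --as helper`, counted 0 · EL♮(3)/EL♮ NOT proved;
resolution in char p NOT proved; nothing of [Hironaka2017] (a candidate under adjudication) is asserted. AI-written.] [folklore]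
-/

set_option linter.dupNamespace false -- mandated namespace `Summit.<Summit>.<Problem>` of this single-conjunct summit

noncomputable section

open MvPolynomial
open Literature.AlgebraicGeometry.Resolution

namespace Summit.ResolutionOfSingularities.ResolutionOfSingularities.Cruxes.EquisingularLiftNat.Sections.LargeChar

/-- Indices of the universal coefficients of a degree-`d` form in `n + 1` variables: exponent vectors with entries `≤ d` and total degree `d`.
[folklore] -/
abbrev HomIdx (n d : ℕ) : Type := {e : Fin (n + 1) → Fin (d + 1) // ∑ i, (e i : ℕ) = d}

/-- **The ring of universal coefficients `ℤ[c_e]` of a degree-`d` form in `n + 1` variables** (a Noetherian ring: finitely many variables over `ℤ`).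
[folklore] -/
abbrev CoeffRingP (n d : ℕ) : Type := MvPolynomial (HomIdx n d) ℤ

/-- **The universal degree-`d` form** `∑_e c_e x^e`, specialised along `φ : ℤ[c] → A`. [folklore] -/
def univHyp (n d : ℕ) {A : Type} [CommRing A] (φ : CoeffRingP n d →+* A) : MvPolynomial (Fin (n + 1)) A :=
  ∑ e : HomIdx n d, monomial (expVec e.1) (φ (X e))

/-- The coefficient assignment `c_e ↦ coeff_{x^e} F` of a polynomial `F` in `n + 1` variables, as a ring map `ℤ[c] → A`. [folklore] -/
def coeffHomP {n d : ℕ} {A : Type} [CommRing A] (F : MvPolynomial (Fin (n + 1)) A) : CoeffRingP n d →+* A :=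
  eval₂Hom (Int.castRingHom A) fun e => coeff (expVec e.1) F

/-- `coeffHomP` on a coefficient variable. [folklore] -/
@[simp] theorem coeffHomP_X {n d : ℕ} {A : Type} [CommRing A] (F : MvPolynomial (Fin (n + 1)) A) (e : HomIdx n d) :
    coeffHomP F (X e : CoeffRingP n d) = coeff (expVec e.1) F := by
  simp [coeffHomP]

/-- The exponent vector of an index has total degree `d`. [folklore] -/
theorem degree_expVec {n d : ℕ} (e : HomIdx n d) : (expVec e.1).degree = d := by
  rw [Finsupp.degree_eq_sum]
  simp only [expVec_apply]
  exact e.2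

/-- ★ **The universal form is homogeneous of degree `d` — over every base, along every `φ`.** [folklore] -/
theorem isHomogeneous_univHyp (n d : ℕ) {A : Type} [CommRing A] (φ : CoeffRingP n d →+* A) :
    (univHyp n d φ).IsHomogeneous d := by
  unfold univHyp
  refine IsHomogeneous.sum _ _ _ fun e _ => ?_
  exact isHomogeneous_monomial _ (degree_expVec e)

/-- **Base change:** `ψ_* (univHyp φ) = univHyp (ψ ∘ φ)` — the family is compatible with every ring map (fibres, generic fibre, `W(k) → k`).
[folklore] -/
theorem map_univHyp (n d : ℕ) {A B : Type} [CommRing A] [CommRing B] (φ : CoeffRingP n d →+* A) (ψ : A →+* B) :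
    MvPolynomial.map ψ (univHyp n d φ) = univHyp n d (ψ.comp φ) := by
  unfold univHyp
  rw [map_sum]
  refine Finset.sum_congr rfl fun e _ => ?_
  rw [map_monomial, RingHom.comp_apply]

/-- The universal form over `ℤ[c]` itself specialises to every member: `φ_* (univHyp id) = univHyp φ`. [folklore] -/
theorem map_univHyp_id (n d : ℕ) {A : Type} [CommRing A] (φ : CoeffRingP n d →+* A) :
    MvPolynomial.map φ (univHyp n d (RingHom.id _)) = univHyp n d φ := by
  rw [map_univHyp, RingHom.comp_id]

/-- For a monomial `x^m` of total degree `d` with all exponents `≤ d`… every exponent of a degree-`d` monomial IS `≤ d`; the index it defines.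
[folklore] -/
theorem exists_homIdx_of_degree_eq {n d : ℕ} (m : Fin (n + 1) →₀ ℕ) (hm : m.degree = d) :
    ∃ e : HomIdx n d, expVec e.1 = m := by
  have hle : ∀ i, m i ≤ d := by
    intro i
    rw [← hm, Finsupp.degree]
    by_cases hi : i ∈ m.support
    · exact Finset.single_le_sum (fun j _ => Nat.zero_le (m j)) hi
    · rw [Finsupp.notMem_support_iff.mp hi]; exact Nat.zero_le _
  have hsum : ∑ i, ((fun i => (⟨m i, Nat.lt_succ_of_le (hle i)⟩ : Fin (d + 1))) i : ℕ) = d := by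
    rw [← Finsupp.degree_eq_sum]
    exact hm
  refine ⟨⟨fun i => ⟨m i, Nat.lt_succ_of_le (hle i)⟩, hsum⟩, ?_⟩
  ext i; simp

/-- ★ **Every degree-`d` form is a specialisation of the universal one:** `univHyp (coeffHomP F) = F` for `F` homogeneous of degree `d`.
[folklore] -/
theorem univHyp_coeffHomP {n d : ℕ} {A : Type} [CommRing A] (F : MvPolynomial (Fin (n + 1)) A) (hF : F.IsHomogeneous d) :
    univHyp n d (coeffHomP F) = F := by
  classical
  unfold univHyp
  simp only [coeffHomP_X]
  ext m
  rw [coeff_sum]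
  simp only [coeff_monomial]
  by_cases hm : m.degree = d
  · obtain ⟨e, he⟩ := exists_homIdx_of_degree_eq m hm
    rw [Finset.sum_eq_single e]
    · rw [if_pos he, he]
    · intro e' _ hne
      rw [if_neg]
      intro h
      exact hne (Subtype.ext (expVec_injective _ _ (h.trans he.symm)))
    · intro h; exact absurd (Finset.mem_univ e) h
  · rw [Finset.sum_eq_zero]
    · symm
      by_contra hne
      apply hm
      have hw : Finsupp.weight (fun _ => 1) m = d := hF hne
      rw [Finsupp.degree_eq_weight_one]
      exact hw
    · intro e _
      rw [if_neg]
      intro h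
      exact hm (h ▸ degree_expVec e)

/-- **Uniqueness of the specialisation:** a ring map `φ : ℤ[c] → A` with `univHyp φ = F` IS `coeffHomP F` (ring maps out of `ℤ[c]` are determined
by the coefficient variables). [folklore] -/
theorem eq_coeffHomP_of_univHyp_eq {n d : ℕ} {A : Type} [CommRing A] (φ : CoeffRingP n d →+* A) (F : MvPolynomial (Fin (n + 1)) A)
    (h : univHyp n d φ = F) : φ = coeffHomP F := by
  classical
  refine MvPolynomial.ringHom_ext (fun z => by simp [coeffHomP]) fun e => ?_
  rw [coeffHomP_X, ← h]
  unfold univHyp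
  rw [coeff_sum]
  simp only [coeff_monomial]
  rw [Finset.sum_eq_single e]
  · rw [if_pos rfl]
  · intro e' _ hne
    rw [if_neg]
    intro h'
    exact hne (Subtype.ext (expVec_injective _ _ h'))
  · intro h'; exact absurd (Finset.mem_univ e) h'

/-- **The only prime number in the kernel of `coeffHomP F : ℤ[c] → k` is the characteristic of `k`** — the residue-characteristic clause of
✓ `exists_bound_forall_prime_of_generic` at a `k`-point of characteristic `p > M` (twin of ✓ `lt_of_prime_mem_ker_coeffHom`). [folklore] -/
theorem lt_of_prime_mem_ker_coeffHomP {n d : ℕ} {k : Type} [Field k] {p : ℕ} [CharP k p] (F : MvPolynomial (Fin (n + 1)) k)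
    {M : ℕ} (hMp : M < p) {q : ℕ} (hq : q.Prime) (hqk : (q : CoeffRingP n d) ∈ RingHom.ker (coeffHomP F)) : M < q := by
  rw [RingHom.mem_ker, map_natCast, CharP.cast_eq_zero_iff k p] at hqk
  rcases (Nat.dvd_prime hq).mp hqk with h1 | hpq
  · exact absurd h1 (CharP.char_ne_one k p)
  · rw [← hpq]; exact hMp

/-- Conversely the characteristic of `k` lies in that kernel. [folklore] -/
theorem char_mem_ker_coeffHomP {n d : ℕ} {k : Type} [Field k] (p : ℕ) [CharP k p] (F : MvPolynomial (Fin (n + 1)) k) :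
    (p : CoeffRingP n d) ∈ RingHom.ker (coeffHomP F) := by
  rw [RingHom.mem_ker, map_natCast, CharP.cast_eq_zero]

/-- The kernel of `coeffHomP F` (target a field) is a prime ideal of the Noetherian ring `ℤ[c]` — the point of `Spec ℤ[c]` the form `F` defines.
[folklore] -/
theorem ker_coeffHomP_isPrime {n d : ℕ} {k : Type} [Field k] (F : MvPolynomial (Fin (n + 1)) k) :
    (RingHom.ker (coeffHomP (n := n) (d := d) F)).IsPrime :=
  RingHom.ker_isPrime _

end Summit.ResolutionOfSingularities.ResolutionOfSingularities.Cruxes.EquisingularLiftNat.Sections.LargeChar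

end
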